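import Summits.QuantumFields.BalabanUV.Beta.SymCorrectorW2Gauge
import Summits.QuantumFields.BalabanUV.Beta.SpineRecursiveParity
import Summits.QuantumFields.BalabanUV.Beta.KernelWardRelative

/-!
# `BalabanUV.Beta.SymCorrectorResponseNull` — road «BF-x», binder row D1, slot (K) ∕ junction (J1), brick TT18: **THE SYMMETRISED RESPONSE REST OF THE
# CHART TRANSPORT IS TADPOLE-NULL AT THE TRANSPORTED KERNEL** (row parity for the two response words, the relative-inverse trace rules for the two response
# contacts) — the `hNr′ ∕ hN0′` pair of `D1BFx/ColumnGaugeTwoPins.hessKer_GcombSh_cancel` for `Nr′ := Rresp`, the symmetrised response rest of the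
# `W2SymOfK` transport (TT14 `SymCorrectorW2Gauge` at both bond orders, halved)
# (the OWNER d1-p2 g24's X3 consumer note (ii): «at `G′` BOTH displayed pieces are `Nr′`: the response word by row parity … and the response contact
# `[Λ_{Y′}, 𝕄]` by the relative-inverse trace rules»; an2 R-D1-g45-5 (3): `SpineRecursiveParity.tadpole_dM_eq_zero_of_rows`).

WHAT (generic `d`, `0 < n`, in-block root offset `r`, `Ψ̂ := psiKS r n`, `K̃ := Ψ̂∘K∘Ψ̂ᵀ` for a spread `K`; TT14's sockets `LocStencil S`, `VertexFamily M n`, `Spr 𝕄`; ONE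
root `ϱ`, field scalar `ξ`; `Y′ ν y′ := −(K∘(Ψ̂ᵀ∘(dM K n S M ν y′ + conjV 𝕄 (Θ ν y′))∘Ψ̂)∘K)` the response kernel of TT14, `Θ[Y] μ y` the `ξ`-face symbol of the column
`colH Y n μ y`; `Rresp μ y ν y′ := ½•((dM (Y′ ν y′) n S M μ y − dM (K2OfK K n S M ν y′) n S M μ y) + (dM (Y′ μ y) n S M ν y′ − dM (K2OfK K n S M μ y) n S M ν y′))
+ ½•(conjV 𝕄 (Θ[Y′ ν y′] μ y) + conjV 𝕄 (Θ[Y′ μ y] ν y′))` — the response pieces of TT14's capstone at `(μ y ν y′)` and at `(ν y′ μ y)`, halved; NO Ward letter enters):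
* §1 [folklore] GENERIC: `tadpole A (conjV 𝕄 Y) = 0` for a relative-inverse triple `RelInv A 𝕄 E` (all spread) and a localised `Y` commuting with `E`
  (`ChartConjugationRelative.trace_KHY_rel − trace_KYH_rel`; = `CombRemainderTadpoleSlot.tadpole_conjV_bhKStepSh_eq_zero` un-pinned).
* §2 [folklore] localisation sockets: the two response words and the two response contacts are `Loc`, hence `Loc (Rresp μ y ν y′)` (`loc_Rresp` — the `hNr′`).
* §3 [folklore] **`tadpole K̃ (Rresp μ y ν y′) = 0`** (`tadpole_Rresp_eq_zero` — the `hN0′`) under the HYPOTHESES: `trK K̃ = sgnK K̃` (sgn-symmetric transported kernel;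
  the literal: `trK_GcombSh`), row-parity-ODD first tables `trK (S κ u) = −sgnK (S κ u)`, `trK (M ρ w) = −sgnK (M ρ w)` (the literal: `trK_SpureRecOf`-class ∕
  `trK_M1Of_symHessFFAt`), a relative-inverse triple `RelInv K̃ 𝕄 E` with `E` spread and commuting with every diagonal kernel (the literal:
  `ChartDefectResolvent.relInv_GcombSh_zero` at `𝕄 = bhK + Dsh`, `E = axEc ρ_c n`, `DiagonalContact.comp_axEc_diagK_comm`) — the two words by
  `SpineRecursiveParity.tadpole_dM_eq_zero_of_rows` (ANY weight kernel), the two contacts by §1.  NO Ward letter is needed for the nullity.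

HONEST DEPENDENCY (cell records, verbatim): «continuum YM on T⁴ ⇐ BetaPertH ∧ nine spine estimates (0/9 proved); BetaPertH ⇐ (D1) ∧ (D4) ∧
CAP+tail; G-an2-4 gates asym, D1 and NE2/3/4.»  HONEST FRAMING (cell contract, verbatim): «discharging `BetaPertH` makes Bałaban's UV stability
UNCONDITIONAL — a real constructive-QFT result; it is NOT the continuum limit and NOT the Clay problem.»  THIS MODULE is [folklore] trace bookkeeping BY NAME over
an2's `ChartConjugationRelative` (trace rules), `TameKernelCalculus` (`tadpole_add`, `Loc` algebra), `KernelWardRelative.tadpole_sub`, lit-balaban's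
`KernelReflection.tadpole_smul`, an1∕leaf-05's `SpineRecursiveParity.tadpole_dM_eq_zero_of_rows`, TT14's `loc_responseKernel ∕ loc_faceGen ∕ decays_of_loc` and TT8's
`loc_dM_of_spr`; the parities and the `RelInv` triple are HYPOTHESES (displayed); the instance is NOT claimed; no definition, no `def … : Prop`, nothing cited, NO printed
hypothesis, 0 sorry.  0∕4 row-D1 binders (hW ∕ hR ∕ D1Tel ∕ D1Rep); (J1) ONE OPEN ROW; (K) NOT closed; NOT D1, NEVER «G-an2-4 closed», NOT `BetaPertH`, NOT continuum,
NOT Clay.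

ABSOLUTE RULE (cell charter, verbatim): «No internally-minted statement may enter as a cited fact. Every hypothesis is either kernel-proved in
this package or a verbatim quotation of a PUBLISHED theorem with page reference. The manuscript(s) under audit are NOT citable for their own
disputed steps — they are the thing under adjudication; programme-internal (2001/route/tribunal) claims are never citable.»

Unit `b2b-balaban-beta-d1-formalise-leaf-03` (gen 31), D1 formalisation swarm LEAF PROVER 03 (the (J1) chart-transport lineage), 2026-08-23.  Not in print; our
bookkeeping.  No existing file touched.
-/

noncomputable section

namespace Summit.QuantumFields.BalabanUV.Beta.SymCorrectorResponseNull

open Finset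
open scoped BigOperators
open Literature.MathematicalPhysics.QuantumFieldTheory
open Literature.MathematicalPhysics.QuantumFieldTheory.Balaban1983to89
open Literature.MathematicalPhysics.QuantumFieldTheory.Balaban1983to89.Beta
open ExpKernelCalculus (MKer Decays VertexFamily comp tr tadpole)
open KernelReflection (tadpole_smul)
open OneStepResolventKernel (Fib LocStencil)
open OneStepKernelFamily (colH)
open SecondOrderResponse (dM K2OfK)
open AffineAveraging (Site box)
open AveragingContours (blk)
open Summit.QuantumFields.BalabanUV.Beta.TameKernelCalculus (Spr Loc trK Spr.comp_loc Loc.comp_spr Loc.add Loc.sub Loc.neg Loc.smul Spr.trK Spr.tame Loc.tame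
  comp_sub_right_tame tr_sub_loc tadpole_add)
open Summit.QuantumFields.BalabanUV.Beta.BorderedHessian (sgnK diagK)
open Summit.QuantumFields.BalabanUV.Beta.ChartConjugation (conjV loc_conjV)
open Summit.QuantumFields.BalabanUV.Beta.ChartConjugationRelative (RelInv spr_comp trace_KHY_rel trace_KYH_rel)
open Summit.QuantumFields.BalabanUV.Beta.KernelWardRelative (tadpole_sub)
open Summit.QuantumFields.BalabanUV.Beta.SpineRecursiveParity (tadpole_dM_eq_zero_of_rows)
open Summit.QuantumFields.BalabanUV.Beta.AveragingWardRootedStencils (legSite)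
open Summit.QuantumFields.BalabanUV.Beta.CompositeCorrectorLocality (blockSitesF)
open Summit.QuantumFields.BalabanUV.Beta.SymCorrectorKernel (psiKS spr_psiKS)
open Summit.QuantumFields.BalabanUV.Beta.SymCorrectorFace (faceWt)
open Summit.QuantumFields.BalabanUV.Beta.SymCorrectorLiteralW (loc_dM_of_spr)
open Summit.QuantumFields.BalabanUV.Beta.SymCorrectorW2Gauge (decays_of_loc loc_faceGen loc_responseKernel)

/-! ## §1 Generic: a contact with the relative-inverse partner has zero tadpole -/

section Generic

variable {D : ℕ} {F : Type*} [Fintype F]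

/-- [folklore] **`tadpole A (conjV 𝕄 Y) = 0` AT A RELATIVE-INVERSE TRIPLE**: for spread `A`, `𝕄`, `E` with `RelInv A 𝕄 E` and a localised `Y` commuting with `E`,
`tr(A∘(𝕄∘Y − Y∘𝕄)) = tr(E∘Y) − tr(E∘Y) = 0` (`trace_KHY_rel`, `trace_KYH_rel`) — the un-pinned form of `CombRemainderTadpoleSlot.tadpole_conjV_bhKStepSh_eq_zero`. -/
theorem tadpole_conjV_eq_zero_of_relInv {A 𝕄 E Y : MKer D F} (hA : Spr A) (hM : Spr 𝕄) (hE : Spr E) (hR : RelInv A 𝕄 E) (hY : Loc Y)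
    (hEY : comp E Y = comp Y E) : tadpole A (conjV 𝕄 Y) = 0 := by
  have h1 := trace_KHY_rel hA hM hE hR hY hEY
  have h2 := trace_KYH_rel hA hM hE hR hY hEY
  unfold ExpKernelCalculus.tadpole
  rw [show conjV 𝕄 Y = comp 𝕄 Y - comp Y 𝕄 from rfl, comp_sub_right_tame hA.tame (hM.comp_loc hY).tame (hY.comp_spr hM).tame,
    tr_sub_loc (hA.comp_loc (hM.comp_loc hY)) (hA.comp_loc (hY.comp_spr hM)), h1, h2, sub_self]

end Generic

/-! ## §2 Localisation of the response rest -/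

variable {d : ℕ} {n : ℕ}

section Rest

variable (hn : 0 < n) {r : Fin (d + 1) → ℕ} (hr : r ∈ box (d + 1) n) {K : MKer (d + 1) (Fib d)} (hK : Spr K)
  {S : Fin (d + 1) → Site (d + 1) → MKer (d + 1) (Fib d)} {Cs δs : ℝ} (hSl : LocStencil S Cs δs) (hδs : 0 < δs)
  {M : Fin (d + 1) → Site (d + 1) → MKer (d + 1) (Fib d)} {CM δM : ℝ} (hMv : VertexFamily M n CM δM) (hδM : 0 < δM)
  {𝕄 : MKer (d + 1) (Fib d)} (hMs : Spr 𝕄) (ϱ : Site (d + 1)) (ξ : ℝ)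
include hn hr hK hSl hδs hMv hδM hMs

omit hSl hδs hMv hδM hMs in
/-- [folklore] The transported kernel `Ψ̂∘K∘Ψ̂ᵀ` is spread. -/
theorem spr_conj_psiKS : Spr (comp (comp (psiKS r n) K) (trK (psiKS r n))) :=
  spr_comp (spr_comp (spr_psiKS hn hr) hK) (spr_psiKS hn hr).trK

/-- [folklore] The response kernel `Y′ ν y′` of TT14 is spread (it is localised: `loc_responseKernel`). -/
theorem spr_responseKernel (ν : Fin (d + 1)) (y' : Site (d + 1)) :
    Spr (-(comp (comp K (comp (comp (trK (psiKS r n))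
      (dM K n S M ν y' + conjV 𝕄 (diagK fun z b => ∑ α : Fin (d + 1), ∑ x ∈ blockSitesF n (blk n (legSite ϱ z b)), colH K n ν y' α x * (ξ * faceWt r n α x))))
      (psiKS r n))) K)) := by
  obtain ⟨δ, C, hδ, -, hYd⟩ := decays_of_loc (loc_responseKernel (ϱ := ϱ) (ξ := ξ) hn hSl hδs hMs hr hK hMv hδM ν y')
  exact ⟨C, δ, hδ, hYd⟩

/-- [folklore] The response WORD `dM (Y′ ν y′) n S M μ y` is localised (TT8 `loc_dM_of_spr` at the spread `Y′`). -/
theorem loc_dM_responseKernel (ν : Fin (d + 1)) (y' : Site (d + 1)) (μ : Fin (d + 1)) (y : Site (d + 1)) :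
    Loc (dM (-(comp (comp K (comp (comp (trK (psiKS r n))
      (dM K n S M ν y' + conjV 𝕄 (diagK fun z b => ∑ α : Fin (d + 1), ∑ x ∈ blockSitesF n (blk n (legSite ϱ z b)), colH K n ν y' α x * (ξ * faceWt r n α x))))
      (psiKS r n))) K)) n S M μ y) := by
  haveI : NeZero n := ⟨hn.ne'⟩
  exact loc_dM_of_spr (spr_responseKernel hn hr hK hSl hδs hMv hδM hMs ϱ ξ ν y') hSl hδs hMv hδM μ y

omit hr hMs in
/-- [folklore] The reference response word `dM (K2OfK K n S M ν y′) n S M μ y` is localised (`K2OfK K … = −K∘dM∘K` is localised, hence spread). -/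
theorem loc_dM_K2OfK (ν : Fin (d + 1)) (y' : Site (d + 1)) (μ : Fin (d + 1)) (y : Site (d + 1)) :
    Loc (dM (K2OfK K n S M ν y') n S M μ y) := by
  haveI : NeZero n := ⟨hn.ne'⟩
  have hD : Loc (dM K n S M ν y') := loc_dM_of_spr hK hSl hδs hMv hδM ν y'
  have hK2 : Loc (K2OfK K n S M ν y') := by
    have e : K2OfK K n S M ν y' = -(comp (comp K (dM K n S M ν y')) K) := by
      funext x z a b
      rfl
    rw [e]
    exact ((hK.comp_loc hD).comp_spr hK).neg
  obtain ⟨δ, C, hδ, -, hd⟩ := decays_of_loc hK2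
  exact loc_dM_of_spr ⟨C, δ, hδ, hd⟩ hSl hδs hMv hδM μ y

/-- [folklore] The response CONTACT `conjV 𝕄 (Θ[Y′ ν y′] μ y)` is localised (`loc_faceGen` at the spread `Y′`, `loc_conjV`). -/
theorem loc_contact_responseKernel (ν : Fin (d + 1)) (y' : Site (d + 1)) (μ : Fin (d + 1)) (y : Site (d + 1)) :
    Loc (conjV 𝕄 (diagK fun z b => ∑ α : Fin (d + 1), ∑ x ∈ blockSitesF n (blk n (legSite ϱ z b)),
      colH (-(comp (comp K (comp (comp (trK (psiKS r n))
        (dM K n S M ν y' + conjV 𝕄 (diagK fun z' b' => ∑ α' : Fin (d + 1), ∑ x' ∈ blockSitesF n (blk n (legSite ϱ z' b')), colH K n ν y' α' x' * (ξ * faceWt r n α' x'))))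
        (psiKS r n))) K)) n μ y α x * (ξ * faceWt r n α x))) :=
  loc_conjV hMs (loc_faceGen hn (spr_responseKernel hn hr hK hSl hδs hMv hδM hMs ϱ ξ ν y') ϱ r ξ μ y)

/-- [folklore] **THE RESPONSE REST IS LOCALISED** (`hNr′` of `hessKer_GcombSh_cancel` for `Nr′ := Rresp`). -/
theorem loc_Rresp (μ : Fin (d + 1)) (y : Site (d + 1)) (ν : Fin (d + 1)) (y' : Site (d + 1)) :
    Loc ((1 / 2 : ℝ) •
          ((dM (-(comp (comp K (comp (comp (trK (psiKS r n))
              (dM K n S M ν y' + conjV 𝕄 (diagK fun z b => ∑ α : Fin (d + 1), ∑ x ∈ blockSitesF n (blk n (legSite ϱ z b)), colH K n ν y' α x * (ξ * faceWt r n α x))))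
              (psiKS r n))) K)) n S M μ y
              - dM (K2OfK K n S M ν y') n S M μ y)
            + (dM (-(comp (comp K (comp (comp (trK (psiKS r n))
              (dM K n S M μ y + conjV 𝕄 (diagK fun z b => ∑ α : Fin (d + 1), ∑ x ∈ blockSitesF n (blk n (legSite ϱ z b)), colH K n μ y α x * (ξ * faceWt r n α x))))
              (psiKS r n))) K)) n S M ν y'
              - dM (K2OfK K n S M μ y) n S M ν y'))
        + (1 / 2 : ℝ) •
          (conjV 𝕄 (diagK fun z b => ∑ α : Fin (d + 1), ∑ x ∈ blockSitesF n (blk n (legSite ϱ z b)),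
              colH (-(comp (comp K (comp (comp (trK (psiKS r n))
                (dM K n S M ν y' + conjV 𝕄 (diagK fun z' b' => ∑ α' : Fin (d + 1), ∑ x' ∈ blockSitesF n (blk n (legSite ϱ z' b')), colH K n ν y' α' x' * (ξ * faceWt r n α' x'))))
                (psiKS r n))) K)) n μ y α x * (ξ * faceWt r n α x))
            + conjV 𝕄 (diagK fun z b => ∑ α : Fin (d + 1), ∑ x ∈ blockSitesF n (blk n (legSite ϱ z b)),
              colH (-(comp (comp K (comp (comp (trK (psiKS r n))
                (dM K n S M μ y + conjV 𝕄 (diagK fun z' b' => ∑ α' : Fin (d + 1), ∑ x' ∈ blockSitesF n (blk n (legSite ϱ z' b')), colH K n μ y α' x' * (ξ * faceWt r n α' x'))))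
                (psiKS r n))) K)) n ν y' α x * (ξ * faceWt r n α x)))) :=
  (Loc.smul _ (((loc_dM_responseKernel hn hr hK hSl hδs hMv hδM hMs ϱ ξ ν y' μ y).sub (loc_dM_K2OfK hn hK hSl hδs hMv hδM ν y' μ y)).add
      ((loc_dM_responseKernel hn hr hK hSl hδs hMv hδM hMs ϱ ξ μ y ν y').sub (loc_dM_K2OfK hn hK hSl hδs hMv hδM μ y ν y')))).add
    (Loc.smul _ ((loc_contact_responseKernel hn hr hK hSl hδs hMv hδM hMs ϱ ξ ν y' μ y).add (loc_contact_responseKernel hn hr hK hSl hδs hMv hδM hMs ϱ ξ μ y ν y')))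

/-! ## §3 The response rest has zero tadpole at the transported kernel -/

/-- [folklore] **THE SYMMETRISED RESPONSE REST IS TADPOLE-NULL AT `K̃ := Ψ̂∘K∘Ψ̂ᵀ`** (`hN0′` of `hessKer_GcombSh_cancel` for `Nr′ := Rresp`): for `K̃` sgn-symmetric
(`trK K̃ = sgnK K̃`), row-parity-ODD first tables `S`, `M`, and a relative-inverse triple `RelInv K̃ 𝕄 E` with `E` spread and commuting with every diagonal kernel,
`tadpole K̃ (Rresp μ y ν y′) = 0` — the two response words by `tadpole_dM_eq_zero_of_rows` (ANY weight kernel: here `Y′ ·` and `K2OfK K n S M ·`), the two response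
contacts by §1.  All three structural inputs are HYPOTHESES (the literal's: `trK_GcombSh`, the `SpureRecOf`∕`M1Of` parities, `relInv_GcombSh_zero` + `comp_axEc_diagK_comm`). -/
theorem tadpole_Rresp_eq_zero (hKt : trK (comp (comp (psiKS r n) K) (trK (psiKS r n))) = sgnK (comp (comp (psiKS r n) K) (trK (psiKS r n))))
    (hSp : ∀ κ u, trK (S κ u) = -sgnK (S κ u)) (hMp : ∀ ρ w, trK (M ρ w) = -sgnK (M ρ w))
    {E : MKer (d + 1) (Fib d)} (hE : Spr E) (hRI : RelInv (comp (comp (psiKS r n) K) (trK (psiKS r n))) 𝕄 E)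
    (hEd : ∀ g : Site (d + 1) → Fib d → ℝ, comp E (diagK g) = comp (diagK g) E)
    (μ : Fin (d + 1)) (y : Site (d + 1)) (ν : Fin (d + 1)) (y' : Site (d + 1)) :
    tadpole (comp (comp (psiKS r n) K) (trK (psiKS r n)))
        ((1 / 2 : ℝ) •
          ((dM (-(comp (comp K (comp (comp (trK (psiKS r n))
              (dM K n S M ν y' + conjV 𝕄 (diagK fun z b => ∑ α : Fin (d + 1), ∑ x ∈ blockSitesF n (blk n (legSite ϱ z b)), colH K n ν y' α x * (ξ * faceWt r n α x))))
              (psiKS r n))) K)) n S M μ y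
              - dM (K2OfK K n S M ν y') n S M μ y)
            + (dM (-(comp (comp K (comp (comp (trK (psiKS r n))
              (dM K n S M μ y + conjV 𝕄 (diagK fun z b => ∑ α : Fin (d + 1), ∑ x ∈ blockSitesF n (blk n (legSite ϱ z b)), colH K n μ y α x * (ξ * faceWt r n α x))))
              (psiKS r n))) K)) n S M ν y'
              - dM (K2OfK K n S M μ y) n S M ν y'))
        + (1 / 2 : ℝ) •
          (conjV 𝕄 (diagK fun z b => ∑ α : Fin (d + 1), ∑ x ∈ blockSitesF n (blk n (legSite ϱ z b)),
              colH (-(comp (comp K (comp (comp (trK (psiKS r n))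
                (dM K n S M ν y' + conjV 𝕄 (diagK fun z' b' => ∑ α' : Fin (d + 1), ∑ x' ∈ blockSitesF n (blk n (legSite ϱ z' b')), colH K n ν y' α' x' * (ξ * faceWt r n α' x'))))
                (psiKS r n))) K)) n μ y α x * (ξ * faceWt r n α x))
            + conjV 𝕄 (diagK fun z b => ∑ α : Fin (d + 1), ∑ x ∈ blockSitesF n (blk n (legSite ϱ z b)),
              colH (-(comp (comp K (comp (comp (trK (psiKS r n))
                (dM K n S M μ y + conjV 𝕄 (diagK fun z' b' => ∑ α' : Fin (d + 1), ∑ x' ∈ blockSitesF n (blk n (legSite ϱ z' b')), colH K n μ y α' x' * (ξ * faceWt r n α' x'))))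
                (psiKS r n))) K)) n ν y' α x * (ξ * faceWt r n α x)))) = 0 := by
  have hKs : Spr (comp (comp (psiKS r n) K) (trK (psiKS r n))) := spr_conj_psiKS hn hr hK
  have hA1 := loc_dM_responseKernel hn hr hK hSl hδs hMv hδM hMs ϱ ξ ν y' μ y
  have hA2 := loc_dM_responseKernel hn hr hK hSl hδs hMv hδM hMs ϱ ξ μ y ν y'
  have hB1 := loc_dM_K2OfK hn hK hSl hδs hMv hδM ν y' μ y
  have hB2 := loc_dM_K2OfK hn hK hSl hδs hMv hδM μ y ν y'
  have hC1 := loc_contact_responseKernel hn hr hK hSl hδs hMv hδM hMs ϱ ξ ν y' μ y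
  have hC2 := loc_contact_responseKernel hn hr hK hSl hδs hMv hδM hMs ϱ ξ μ y ν y'
  -- the four vanishing tadpoles
  have zA1 := tadpole_dM_eq_zero_of_rows hKs hKt _ n hSp hMp μ y hA1
  have zA2 := tadpole_dM_eq_zero_of_rows hKs hKt _ n hSp hMp ν y' hA2
  have zB1 := tadpole_dM_eq_zero_of_rows hKs hKt _ n hSp hMp μ y hB1
  have zB2 := tadpole_dM_eq_zero_of_rows hKs hKt _ n hSp hMp ν y' hB2
  have zC1 := tadpole_conjV_eq_zero_of_relInv hKs hMs hE hRI
    (loc_faceGen hn (spr_responseKernel hn hr hK hSl hδs hMv hδM hMs ϱ ξ ν y') ϱ r ξ μ y) (hEd _)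
  have zC2 := tadpole_conjV_eq_zero_of_relInv hKs hMs hE hRI
    (loc_faceGen hn (spr_responseKernel hn hr hK hSl hδs hMv hδM hMs ϱ ξ μ y) ϱ r ξ ν y') (hEd _)
  rw [tadpole_add hKs (Loc.smul _ ((hA1.sub hB1).add (hA2.sub hB2))) (Loc.smul _ (hC1.add hC2)), tadpole_smul, tadpole_smul,
    tadpole_add hKs (hA1.sub hB1) (hA2.sub hB2), tadpole_sub hKs hA1 hB1, tadpole_sub hKs hA2 hB2, tadpole_add hKs hC1 hC2,
    zA1, zA2, zB1, zB2, zC1, zC2]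
  ring

end Rest

end Summit.QuantumFields.BalabanUV.Beta.SymCorrectorResponseNull

end
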